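import Mathlib.LinearAlgebra.Matrix.SpecialLinearGroup
import Mathlib.LinearAlgebra.Matrix.Notation
import Mathlib.Data.ZMod.Basic
import Mathlib.GroupTheory.SpecificGroups.Alternating
import Mathlib.SetTheory.Cardinal.Finite
import Literature.Combinatorics.Additive.TripleProductProperty
import Literature.Computability.AlgebraicComplexity.CohnUmansTPP
import Literature.Computability.AlgebraicComplexity.CohnUmansDihedralSubgroupTPP
import HarnessLib

/-!
# The `SL₂(𝔽_q)` / `PSL₂(𝔽_q)` rows of Hedtke–Murthy's subgroup-TPP tables: `SL₂(𝔽₃)`, `SL₂(𝔽₅)`, `SL₂(𝔽₇)`,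
# `A₅ ≅ PSL₂(𝔽₅)`, `A₆ ≅ PSL₂(𝔽₉)` realize `⟨4,3,3⟩`, `⟨24,3,3⟩`, `⟨16,7,7⟩`, `⟨12,3,3⟩`, `⟨12,9,9⟩` through subgroups

Topic `Literature/Computability/AlgebraicComplexity` (group-theoretic matrix multiplication; companion of
`CohnUmansTPP.lean` (`RealizesTPP`), `CohnUmansDihedralSubgroupTPP.lean` (`SubgroupTPP`) and
`TPPCapacitySL3F2.lean` (Lemma 7.1 of the same paper: `SL₃(𝔽₂)` realizes `⟨8,7,7⟩`)).

I. Hedtke, S. Murthy, *Search and test algorithms for triple product property triples*, Groups Complex.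
Cryptol. 4 (2012) 111–133, doi:10.1515/gcc-2012-0006 = arXiv:1104.5097v2 (11 May 2011; "14 pages, 2 figures,
4 tables"). Read first-hand from the arXiv e-print source (`2011TPPAlgorithms.tex`, sha256 prefix `fa8eeeba4eaa9c6c`;
the held text layer `paper:arxiv-1104.5097` omits the tables), §7.3 "Selected Results for `SL_n𝔽_q` and `PSL₂𝔽_q`":

> We also tested some groups of type `SL_n𝔽_q` and `PSL₂𝔽_q`. The results are shown in the tables 3 and 4. These are
> groups that realize a relatively high *TPP subgroup ratio* `ρ(G) := β(G)/|G|`. No other tested groups obtain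
> ratios bigger than `4`. (tex L754)

Here `β_g(G) := max {npm : G realizes ⟨n,p,m⟩ through subgroups}` is the *TPP subgroup capacity* (Def. `def:TPPcap` in §1, tex
L125–L128: "`β(G) := max{npm : G realizes ⟨n,p,m⟩}` and the *TPP subgroup capacity* of `G` as
`β_g(G) := max{npm : G realizes ⟨n,p,m⟩ through subgroups}`"). The rows re-derived in this file (columns
`Group | D₃(G) | |G| | β_g(G) | β_g/D₃ | β_g/|G| | ⟨n,p,m⟩`, verbatim):

* Table 3 (`tab:PSL`, "Computational results for selected groups of type `PSL₂𝔽_q`", tex L794–L813):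
  `PSL₂𝔽₄ | 244 | 60 | 108 | 0.442623 | 1.8 | 12,3,3` (L801), `PSL₂𝔽₅ | 244 | 60 | 108 | 0.442623 | 1.8 | 12,3,3`
  (L802), `PSL₂𝔽₉ | 3004 | 360 | 972 | 0.323569 | 2.7 | 12,9,9` (L805).
* Table 4 (`tab:SL`, "Computational results for selected groups of type `SL_n𝔽_q`", tex L814–L829):
  `SL₂𝔽₃ | 54 | 24 | 36 | 0.666667 | 1.5 | 4,3,3` (L820), `SL₂𝔽₄ | 244 | 60 | 108 | 0.442623 | 1.8 | 12,3,3`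
  (L821), `SL₂𝔽₅ | 540 | 120 | 216 | 0.4 | 1.8 | 24,3,3` (L822), `SL₂𝔽₇ | 2198 | 336 | 784 | 0.356688 | 2.33333 |
  16,7,7` (L823).
  (The `SL₂𝔽₃` row is also row `[24,3]` of Table 1 (`tab:small`), L708: `β = β_g = 36`, `⟨4,3,3⟩`.)

## What is formalized (all proved; `0 defs / 0 facts`)
The printed values are results of a brute-force computation (§6, "`OUTPUT: subgroups S_max, T_max, U_max that
realize a problem of size β_g(G)`", L572); the paper prints the realizing subgroup triple only for `SL₃𝔽₂`
(Lemma 7.1 = `TPPCapacitySL3F2.lean`). This file re-derives the **lower halves** `β_g(G) ≥` (the existence of a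
TPP triple of SUBGROUPS of the printed orders) of the five rows above in groups Mathlib can compute in, with explicit
triples (found by a small search, then decided by the kernel — every group-theoretic identity below is a
`decide +kernel` computation on `2 × 2` matrices over `ZMod p` or on permutations of `Fin 5` / `Fin 6`):

* `SL₂(𝔽₃) = SL(2, ZMod 3)`: `S = ⟨[0 1; 2 0]⟩` (cyclic of order `4`), `T = ⟨[1 1; 0 1]⟩`, `U = ⟨[1 0; 1 1]⟩`
  (order `3`): `HedtkeMurthy2012_tableSL_sl2f3{_triple,_subgroups,}` — `⟨4,3,3⟩`, `36 = (3/2)·24`.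
* `SL₂(𝔽₅) = SL(2, ZMod 5)`: `S = {aⁱ bʲ cᵏ} = ⟨a, b, c⟩` with `a = [0 1; 4 0]`, `b = [0 2; 2 0]` (a quaternion
  group `Q₈ = {aⁱbʲ}`) and `c = [1 1; 2 3]` of order `3` — the binary tetrahedral subgroup `SL₂(𝔽₃) ≅ 2T` of order
  `24`; `T = ⟨[0 3; 3 4]⟩`, `U = ⟨[0 2; 2 4]⟩` (order `3`): `HedtkeMurthy2012_tableSL_sl2f5{_triple,_subgroups,}` —
  `⟨24,3,3⟩`, `216 = (9/5)·120`.
* `SL₂(𝔽₇) = SL(2, ZMod 7)`: `S = {aⁱ bʲ : i < 8, j < 2}` with `a = [2 1; 3 2]` (order `8`), `b = [2 2; 1 5]`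
  (order `4`, `b² = a⁴ = -1`, `b a b⁻¹ = a⁻¹`) — a generalized quaternion Sylow `2`-subgroup `Q₁₆`; `T = ⟨[1 1; 0 1]⟩`,
  `U = ⟨[1 0; 1 1]⟩` (the upper / lower unitriangular matrices, order `7`):
  `HedtkeMurthy2012_tableSL_sl2f7{_triple,_subgroups,}` — `⟨16,7,7⟩`, `784 = (7/3)·336`.
* `A₅ = alternatingGroup (Fin 5)`: `S = A₄` (the even permutations of `{0,1,2,3}`, written `{aⁱbʲcᵏ}` with
  `a = (0 1)(2 3)`, `b = (0 2)(1 3)`, `c = (0 1 2)`), `T = ⟨(0 1 4)⟩`, `U = ⟨(2 3 4)⟩`: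
  `HedtkeMurthy2012_tablePSL_alt5{_triple,_subgroups,}` — `⟨12,3,3⟩`, `108 = (9/5)·60`.
* `A₆ = alternatingGroup (Fin 6)`: the same `S = A₄` on `{0,1,2,3}`, `T = ⟨(0 1 4), (2 5 3)⟩`,
  `U = ⟨(2 3 4), (0 1 5)⟩` (elementary abelian of order `9`): `HedtkeMurthy2012_tablePSL_alt6{_triple,_subgroups,}` —
  `⟨12,9,9⟩`, `972 = (27/10)·360`.

SCOPE (read before citing). (1) Only the LOWER halves are formalized: the printed equalities `β_g(G) = …` (no
subgroup triple does better) are computational claims of the paper and are not re-derived here. (2) The printed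
rows concern `PSL₂𝔽₄`, `PSL₂𝔽₅`, `SL₂𝔽₄` and `PSL₂𝔽₉`; the kernel statements are about `alternatingGroup (Fin 5)`
and `alternatingGroup (Fin 6)`, i.e. they re-derive those rows only up to the classical exceptional isomorphisms
`PSL₂(𝔽₄) ≅ PSL₂(𝔽₅) ≅ SL₂(𝔽₄) ≅ A₅` and `PSL₂(𝔽₉) ≅ A₆`, which are NOT formalized in this file (nor in Mathlib).
(3) The rows `PSL₂𝔽₂ ≅ S₃` (`⟨2,2,2⟩`) and `PSL₂𝔽₃ ≅ A₄` (`⟨3,3,2⟩`) are the tree's `realizesTPP_perm_fin_three`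
(PseudoExponentBounds.lean) and `tpp_perm_fin_four_332` (TPPCapacityIndexFour.lean); `PSL₂𝔽₇ ≅ SL₃𝔽₂` (`⟨8,7,7⟩`)
is `TPPCapacitySL3F2.lean`; the rows `PSL₂𝔽₈ = SL₂𝔽₈`, `PSL₂𝔽₁₁ … PSL₂𝔽₁₉` are not treated (no computable model
of those groups is set up here).

The step "three subgroups with `T ∩ U = 1` and `S ∩ TU = 1` form a (basic) TPP triple" is Hedtke–Murthy's Thm. 3.1
specialised to subgroups (`Q(X) = X`); it is packaged once as the private glue lemma `subgroupTriple_of_carrierFacts`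
(hypothesis in the combined form "`b c ∈ S ⇒ b = c = 1`"), cf. `tripleProductProperty_of_mulClosed` in
`TPPCapacitySL3F2.lean` and `HedtkeMurthy2012_thm31` in `Combinatorics/Additive/TPPBasicTripleCriterion.lean`.

## References
* I. Hedtke, S. Murthy, arXiv:1104.5097v2 = Groups Complex. Cryptol. 4 (2012): §7.3, Table 3 (`tab:PSL`) rows
  `PSL₂𝔽₄`, `PSL₂𝔽₅`, `PSL₂𝔽₉`; Table 4 (`tab:SL`) rows `SL₂𝔽₃`, `SL₂𝔽₄`, `SL₂𝔽₅`, `SL₂𝔽₇`; Thm. 3.1; Def. of `β_g`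
  (§1, `def:TPPcap`). [HedtkeMurthy2012]
* H. Cohn, C. Umans, FOCS 2003, arXiv:math/0307321: Def. 2.1 (triple product property; remark on subgroups).
  [CohnUmans2003]
-/

namespace Literature.Computability.AlgebraicComplexity

open Matrix Equiv Literature.Combinatorics.Additive Literature.Computability.AlgebraicComplexity.DihedralSubgroups

/-! ## Glue: carriers of subgroups with `b c ∈ S ⇒ b = c = 1` give a TPP triple of subgroups -/

section General

variable {G : Type*} [Group G]

/-- In a finite set in which every element has a right inverse inside the set, inverses stay inside. [folklore] -/
private theorem inv_mem_of_mul_eq_one {X : Finset G} (hX : ∀ x ∈ X, ∃ y ∈ X, x * y = 1) {x : G} (hx : x ∈ X) :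
    x⁻¹ ∈ X := by
  obtain ⟨y, hy, hxy⟩ := hX x hx
  rw [inv_eq_of_mul_eq_one_right hxy]
  exact hy

/-- **Glue (Hedtke–Murthy 2012, Thm. 3.1 for subgroups: `T ∩ U = 1 ∧ S ∩ TU = 1` ⇒ `(S,T,U)` is a basic TPP
triple).** If the finite sets `S, T, U ⊆ G` are carriers of subgroups (contain `1`, closed under products,
inverses inside) of sizes `nS, nT, nU`, and `b c ∈ S` with `b ∈ T`, `c ∈ U` forces `b = c = 1` (this is
"`T ∩ U = 1` and `S ∩ TU = 1`" in one clause), then `(S, T, U)` has the triple product property (right-quotient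
form of the tree), and there are subgroups `H₁, H₂, H₃ ≤ G` with these carriers, of orders `nS, nT, nU`, satisfying
`SubgroupTPP H₁ H₂ H₃`. Proof: `a b c = 1` gives `b c = a⁻¹ ∈ S`; for carriers of subgroups the quotient sets are
the sets themselves. [cite: HedtkeMurthy2012, Thm. 3.1] -/
private theorem subgroupTriple_of_carrierFacts {S T U : Finset G} {nS nT nU : ℕ}
    (hS : S.card = nS ∧ (1 : G) ∈ S ∧ (∀ x ∈ S, ∀ y ∈ S, x * y ∈ S) ∧ (∀ x ∈ S, ∃ y ∈ S, x * y = 1))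
    (hT : T.card = nT ∧ (1 : G) ∈ T ∧ (∀ x ∈ T, ∀ y ∈ T, x * y ∈ T) ∧ (∀ x ∈ T, ∃ y ∈ T, x * y = 1))
    (hU : U.card = nU ∧ (1 : G) ∈ U ∧ (∀ x ∈ U, ∀ y ∈ U, x * y ∈ U) ∧ (∀ x ∈ U, ∃ y ∈ U, x * y = 1))
    (hkey : ∀ b ∈ T, ∀ c ∈ U, b * c ∈ S → b = 1 ∧ c = 1) :
    (TripleProductProperty S T U ∧ S.card = nS ∧ T.card = nT ∧ U.card = nU) ∧
      ∃ H₁ H₂ H₃ : Subgroup G, (H₁ : Set G) = S ∧ (H₂ : Set G) = T ∧ (H₃ : Set G) = U ∧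
        Nat.card H₁ = nS ∧ Nat.card H₂ = nT ∧ Nat.card H₃ = nU ∧ SubgroupTPP H₁ H₂ H₃ := by
  obtain ⟨hcS, h1S, hmS, hiS⟩ := hS
  obtain ⟨hcT, h1T, hmT, hiT⟩ := hT
  obtain ⟨hcU, h1U, hmU, hiU⟩ := hU
  -- the subgroup condition `a b c = 1 ⇒ a = b = c = 1`
  have hcond : ∀ a ∈ S, ∀ b ∈ T, ∀ c ∈ U, a * b * c = 1 → a = 1 ∧ b = 1 ∧ c = 1 := by
    intro a ha b hb c hc habc
    have hinv : a⁻¹ = b * c := inv_eq_of_mul_eq_one_right (by rw [← mul_assoc]; exact habc)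
    obtain ⟨hb1, hc1⟩ := hkey b hb c hc (hinv ▸ inv_mem_of_mul_eq_one hiS ha)
    refine ⟨?_, hb1, hc1⟩
    rwa [hb1, hc1, mul_one, mul_one] at habc
  refine ⟨⟨?_, hcS, hcT, hcU⟩, ?_⟩
  · -- right-quotient TPP: the quotients `s s'⁻¹, t t'⁻¹, u u'⁻¹` lie in `S, T, U` again
    intro s hs s' hs' t ht t' ht' u hu u' hu' he
    obtain ⟨h1, h2, h3⟩ := hcond _ (hmS _ hs _ (inv_mem_of_mul_eq_one hiS hs')) _
      (hmT _ ht _ (inv_mem_of_mul_eq_one hiT ht')) _ (hmU _ hu _ (inv_mem_of_mul_eq_one hiU hu')) he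
    exact ⟨mul_inv_eq_one.1 h1, mul_inv_eq_one.1 h2, mul_inv_eq_one.1 h3⟩
  · -- the three subgroups with carriers `S, T, U`
    have card_eq : ∀ (H : Subgroup G) (X : Finset G), (H : Set G) = X → Nat.card H = X.card := by
      intro H X e
      rw [← SetLike.coe_sort_coe, e, Finset.coe_sort_coe, Nat.card_eq_fintype_card, Fintype.card_coe]
    refine ⟨{ carrier := S, mul_mem' := fun hx hy => hmS _ hx _ hy, one_mem' := h1S,
              inv_mem' := fun hx => inv_mem_of_mul_eq_one hiS hx },
            { carrier := T, mul_mem' := fun hx hy => hmT _ hx _ hy, one_mem' := h1T,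
              inv_mem' := fun hx => inv_mem_of_mul_eq_one hiT hx },
            { carrier := U, mul_mem' := fun hx hy => hmU _ hx _ hy, one_mem' := h1U,
              inv_mem' := fun hx => inv_mem_of_mul_eq_one hiU hx },
            rfl, rfl, rfl, (card_eq _ _ rfl).trans hcS, (card_eq _ _ rfl).trans hcT, (card_eq _ _ rfl).trans hcU, ?_⟩
    intro a ha b hb c hc habc
    exact hcond a ha b hb c hc habc

/-- Transport into a subgroup `K`: a TPP triple of `G` all of whose members lie in `K` makes `K` (as a group)
realize `⟨|S|, |T|, |U|⟩` — pull the sets back along the inclusion `K.subtype`. [folklore] -/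
private theorem realizesTPP_subgroup_of_subset [DecidableEq G] (K : Subgroup G) {S T U : Finset G}
    (hS : ∀ x ∈ S, x ∈ K) (hT : ∀ x ∈ T, x ∈ K) (hU : ∀ x ∈ U, x ∈ K) (h : TripleProductProperty S T U) :
    RealizesTPP K S.card T.card U.card := by
  classical
  have hinj : Function.Injective K.subtype := K.subtype_injective
  refine ⟨S.preimage K.subtype hinj.injOn, T.preimage K.subtype hinj.injOn, U.preimage K.subtype hinj.injOn,
    ?_, ?_, ?_, ?_⟩
  · rw [Finset.card_preimage, Finset.filter_true_of_mem fun x hx => ⟨⟨x, hS x hx⟩, rfl⟩]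
  · rw [Finset.card_preimage, Finset.filter_true_of_mem fun x hx => ⟨⟨x, hT x hx⟩, rfl⟩]
  · rw [Finset.card_preimage, Finset.filter_true_of_mem fun x hx => ⟨⟨x, hU x hx⟩, rfl⟩]
  · intro s hs s' hs' t ht t' ht' u hu u' hu' hrel
    simp only [Finset.mem_preimage] at hs hs' ht ht' hu hu'
    have hrel' : (s : G) * (s' : G)⁻¹ * ((t : G) * (t' : G)⁻¹) * ((u : G) * (u' : G)⁻¹) = 1 := by
      simpa only [map_mul, map_inv, map_one, Subgroup.coe_subtype] using congrArg K.subtype hrel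
    obtain ⟨e1, e2, e3⟩ := h _ hs _ hs' _ ht _ ht' _ hu _ hu' hrel'
    exact ⟨Subtype.ext e1, Subtype.ext e2, Subtype.ext e3⟩

/-- Transport of the subgroup triple product property to `K`: for `Hᵢ ≤ G` the subgroups `Hᵢ ⊓ K` of `K`
(`Subgroup.subgroupOf`) again satisfy `SubgroupTPP`. [folklore] -/
private theorem subgroupTPP_subgroupOf (K H₁ H₂ H₃ : Subgroup G) (h : SubgroupTPP H₁ H₂ H₃) :
    SubgroupTPP (H₁.subgroupOf K) (H₂.subgroupOf K) (H₃.subgroupOf K) := by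
  intro a ha b hb c hc habc
  rw [Subgroup.mem_subgroupOf] at ha hb hc
  have habc' : (a : G) * b * c = 1 := by
    simpa only [map_mul, map_one, Subgroup.coe_subtype] using congrArg K.subtype habc
  obtain ⟨e1, e2, e3⟩ := h _ ha _ hb _ hc habc'
  exact ⟨OneMemClass.coe_eq_one.mp e1, OneMemClass.coe_eq_one.mp e2, OneMemClass.coe_eq_one.mp e3⟩

/-- Re-bracketing of a five-fold conjunction. [folklore] -/
private theorem and_assoc4 {p q r s t : Prop} (h : p ∧ q ∧ r ∧ s ∧ t) : (p ∧ q ∧ r ∧ s) ∧ t :=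
  ⟨⟨h.1, h.2.1, h.2.2.1, h.2.2.2.1⟩, h.2.2.2.2⟩

/-- A subgroup of `Sₙ` whose carrier is a finite set of even permutations has, viewed inside `Aₙ`
(`Subgroup.subgroupOf`), the same order. [folklore] -/
private theorem card_subgroupOf_of_sign {n : ℕ} (H : Subgroup (Perm (Fin n))) {X : Finset (Perm (Fin n))}
    (e : (H : Set (Perm (Fin n))) = X) (hX : ∀ x ∈ X, Perm.sign x = 1) :
    Nat.card (H.subgroupOf (alternatingGroup (Fin n))) = Nat.card H := by
  have hle : H ≤ alternatingGroup (Fin n) := by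
    intro x hx
    have hx' : x ∈ (X : Set (Perm (Fin n))) := e ▸ hx
    exact Perm.mem_alternatingGroup.mpr (hX x (Finset.mem_coe.mp hx'))
  exact Nat.card_congr (Subgroup.subgroupOfEquivOfLe hle).toEquiv

end General

/-! ## `SL₂(𝔽₃)`: `⟨4, 3, 3⟩` (Table 4 row `SL₂𝔽₃`; Table 1 row `[24,3]`) -/

section SL2F3

open scoped MatrixGroups

/-- Carrier facts for `S = {sⁱ : i < 4}`, `s = [0 1; 2 0]` (cyclic of order `4`) (kernel computation): size `4`,
contains `1`, closed under products, inverses inside. [cite: HedtkeMurthy2012, Table 4 (tab:SL) row SL₂𝔽₃] -/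
private theorem factsS_sl2f3 :
    let s : SL(2, ZMod 3) := ⟨!![0, 1; 2, 0], by decide⟩
    let X := (Finset.range 4).image (s ^ ·)
    X.card = 4 ∧ (1 : SL(2, ZMod 3)) ∈ X ∧ (∀ x ∈ X, ∀ y ∈ X, x * y ∈ X) ∧
      (∀ x ∈ X, ∃ y ∈ X, x * y = 1) := by
  decide +kernel

/-- Carrier facts for `T = {tⁱ : i < 3}`, `t = [1 1; 0 1]` (kernel computation): size `3`, contains `1`, closed under
products, inverses inside. [cite: HedtkeMurthy2012, Table 4 (tab:SL) row SL₂𝔽₃] -/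
private theorem factsT_sl2f3 :
    let t : SL(2, ZMod 3) := ⟨!![1, 1; 0, 1], by decide⟩
    let X := (Finset.range 3).image (t ^ ·)
    X.card = 3 ∧ (1 : SL(2, ZMod 3)) ∈ X ∧ (∀ x ∈ X, ∀ y ∈ X, x * y ∈ X) ∧
      (∀ x ∈ X, ∃ y ∈ X, x * y = 1) := by
  decide +kernel

/-- Carrier facts for `U = {uʲ : j < 3}`, `u = [1 0; 1 1]` (kernel computation): size `3`, contains `1`, closed under
products, inverses inside. [cite: HedtkeMurthy2012, Table 4 (tab:SL) row SL₂𝔽₃] -/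
private theorem factsU_sl2f3 :
    let u : SL(2, ZMod 3) := ⟨!![1, 0; 1, 1], by decide⟩
    let X := (Finset.range 3).image (u ^ ·)
    X.card = 3 ∧ (1 : SL(2, ZMod 3)) ∈ X ∧ (∀ x ∈ X, ∀ y ∈ X, x * y ∈ X) ∧
      (∀ x ∈ X, ∃ y ∈ X, x * y = 1) := by
  decide +kernel

/-- The key clause (kernel computation over `|T|·|U| = 9` products): `g h ∈ S` with `g ∈ T`,
`h ∈ U` only for `g = h = 1` — i.e. "`T ∩ U = 1` and `S ∩ TU = 1`".
[cite: HedtkeMurthy2012, Table 4 (tab:SL) row SL₂𝔽₃] -/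
private theorem key_sl2f3 :
    let s : SL(2, ZMod 3) := ⟨!![0, 1; 2, 0], by decide⟩
    let t : SL(2, ZMod 3) := ⟨!![1, 1; 0, 1], by decide⟩
    let u : SL(2, ZMod 3) := ⟨!![1, 0; 1, 1], by decide⟩
    let S := (Finset.range 4).image (s ^ ·)
    let T := (Finset.range 3).image (t ^ ·)
    let U := (Finset.range 3).image (u ^ ·)
    ∀ g ∈ T, ∀ h ∈ U, g * h ∈ S → g = 1 ∧ h = 1 := by
  decide +kernel

/-- `|SL₂(𝔽₃)| = 24` (kernel count; the printed `|G|` column).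
[cite: HedtkeMurthy2012, Table 4 (tab:SL) row SL₂𝔽₃] -/
private theorem card_sl2f3 : Fintype.card SL(2, ZMod 3) = 24 := by
  decide +kernel

/-- **Hedtke–Murthy 2012, Table 4 row `SL₂𝔽₃` (`⟨4,3,3⟩`), the triple**: in `SL₂(𝔽₃)` the sets `S = ⟨[0 1; 2 0]⟩` (order
`4`), `T = ⟨[1 1; 0 1]⟩`, `U = ⟨[1 0; 1 1]⟩` (order `3`) satisfy the triple product property. [cite:
HedtkeMurthy2012, Table 4 (tab:SL) row SL₂𝔽₃] -/
theorem HedtkeMurthy2012_tableSL_sl2f3_triple :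
    let s : SL(2, ZMod 3) := ⟨!![0, 1; 2, 0], by decide⟩
    let t : SL(2, ZMod 3) := ⟨!![1, 1; 0, 1], by decide⟩
    let u : SL(2, ZMod 3) := ⟨!![1, 0; 1, 1], by decide⟩
    let S := (Finset.range 4).image (s ^ ·)
    let T := (Finset.range 3).image (t ^ ·)
    let U := (Finset.range 3).image (u ^ ·)
    TripleProductProperty S T U ∧ S.card = 4 ∧ T.card = 3 ∧ U.card = 3 := by
  obtain ⟨hS, hT, hU, hkey⟩ := (⟨factsS_sl2f3, factsT_sl2f3, factsU_sl2f3, key_sl2f3⟩ : _ ∧ _ ∧ _ ∧ _)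
  exact (subgroupTriple_of_carrierFacts hS hT hU hkey).1

/-- **Hedtke–Murthy 2012, Table 4 row `SL₂𝔽₃` ("through subgroups")**: `SL₂(𝔽₃)` has subgroups of orders
`4, 3, 3` satisfying the subgroup triple product property, i.e. `β_g ≥ 36` for this group.
[cite: HedtkeMurthy2012, Table 4 (tab:SL) row SL₂𝔽₃] -/
theorem HedtkeMurthy2012_tableSL_sl2f3_subgroups :
    ∃ H₁ H₂ H₃ : Subgroup SL(2, ZMod 3), Nat.card H₁ = 4 ∧ Nat.card H₂ = 3 ∧ Nat.card H₃ = 3 ∧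
      SubgroupTPP H₁ H₂ H₃ := by
  obtain ⟨-, H₁, H₂, H₃, -, -, -, h1, h2, h3, h⟩ :=
    subgroupTriple_of_carrierFacts factsS_sl2f3 factsT_sl2f3 factsU_sl2f3 key_sl2f3
  exact ⟨H₁, H₂, H₃, h1, h2, h3, h⟩

/-- **Hedtke–Murthy 2012, Table 4 row `SL₂𝔽₃`**: `SL₂(𝔽₃)` realizes `⟨4,3,3⟩`; `|G| = 24` and
`36 = (3/2)·24` (printed ratio `β_g/|G| = 1.5`). [cite: HedtkeMurthy2012, Table 4 (tab:SL) row SL₂𝔽₃] -/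
theorem HedtkeMurthy2012_tableSL_sl2f3 :
    RealizesTPP SL(2, ZMod 3) 4 3 3 ∧ Nat.card SL(2, ZMod 3) = 24 ∧
      2 * (4 * 3 * 3) = 3 * Nat.card SL(2, ZMod 3) := by
  have hc : Nat.card SL(2, ZMod 3) = 24 := by rw [Nat.card_eq_fintype_card]; exact card_sl2f3
  obtain ⟨htpp, h1, h2, h3⟩ := HedtkeMurthy2012_tableSL_sl2f3_triple
  exact ⟨⟨_, _, _, h1, h2, h3, htpp⟩, hc, by rw [hc]⟩

end SL2F3

/-! ## `SL₂(𝔽₅)`: `⟨24, 3, 3⟩` (Table 4 row `SL₂𝔽₅`) -/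

section SL2F5

open scoped MatrixGroups

/-- Carrier facts for `S = {aⁱbʲcᵏ : i < 4, j < 2, k < 3}` with `a = [0 1; 4 0]`, `b = [0 2; 2 0]`, `c = [1 1; 2 3]`
(binary tetrahedral, order `24`) (kernel computation): size `24`, contains `1`, closed under products, inverses
inside. [cite: HedtkeMurthy2012, Table 4 (tab:SL) row SL₂𝔽₅] -/
private theorem factsS_sl2f5 :
    let a : SL(2, ZMod 5) := ⟨!![0, 1; 4, 0], by decide⟩
    let b : SL(2, ZMod 5) := ⟨!![0, 2; 2, 0], by decide⟩
    let c : SL(2, ZMod 5) := ⟨!![1, 1; 2, 3], by decide⟩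
    let X := (Finset.range 4 ×ˢ Finset.range 2 ×ˢ Finset.range 3).image (fun ijk => a ^ ijk.1 * b ^ ijk.2.1 * c ^ ijk.2.2)
    X.card = 24 ∧ (1 : SL(2, ZMod 5)) ∈ X ∧ (∀ x ∈ X, ∀ y ∈ X, x * y ∈ X) ∧
      (∀ x ∈ X, ∃ y ∈ X, x * y = 1) := by
  decide +kernel

/-- Carrier facts for `T = {tⁱ : i < 3}`, `t = [0 3; 3 4]` (kernel computation): size `3`, contains `1`, closed under
products, inverses inside. [cite: HedtkeMurthy2012, Table 4 (tab:SL) row SL₂𝔽₅] -/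
private theorem factsT_sl2f5 :
    let t : SL(2, ZMod 5) := ⟨!![0, 3; 3, 4], by decide⟩
    let X := (Finset.range 3).image (t ^ ·)
    X.card = 3 ∧ (1 : SL(2, ZMod 5)) ∈ X ∧ (∀ x ∈ X, ∀ y ∈ X, x * y ∈ X) ∧
      (∀ x ∈ X, ∃ y ∈ X, x * y = 1) := by
  decide +kernel

/-- Carrier facts for `U = {uʲ : j < 3}`, `u = [0 2; 2 4]` (kernel computation): size `3`, contains `1`, closed under
products, inverses inside. [cite: HedtkeMurthy2012, Table 4 (tab:SL) row SL₂𝔽₅] -/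
private theorem factsU_sl2f5 :
    let u : SL(2, ZMod 5) := ⟨!![0, 2; 2, 4], by decide⟩
    let X := (Finset.range 3).image (u ^ ·)
    X.card = 3 ∧ (1 : SL(2, ZMod 5)) ∈ X ∧ (∀ x ∈ X, ∀ y ∈ X, x * y ∈ X) ∧
      (∀ x ∈ X, ∃ y ∈ X, x * y = 1) := by
  decide +kernel

/-- The key clause (kernel computation over `|T|·|U| = 9` products): `g h ∈ S` with `g ∈ T`,
`h ∈ U` only for `g = h = 1` — i.e. "`T ∩ U = 1` and `S ∩ TU = 1`".
[cite: HedtkeMurthy2012, Table 4 (tab:SL) row SL₂𝔽₅] -/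
private theorem key_sl2f5 :
    let a : SL(2, ZMod 5) := ⟨!![0, 1; 4, 0], by decide⟩
    let b : SL(2, ZMod 5) := ⟨!![0, 2; 2, 0], by decide⟩
    let c : SL(2, ZMod 5) := ⟨!![1, 1; 2, 3], by decide⟩
    let t : SL(2, ZMod 5) := ⟨!![0, 3; 3, 4], by decide⟩
    let u : SL(2, ZMod 5) := ⟨!![0, 2; 2, 4], by decide⟩
    let S := (Finset.range 4 ×ˢ Finset.range 2 ×ˢ Finset.range 3).image (fun ijk => a ^ ijk.1 * b ^ ijk.2.1 * c ^ ijk.2.2)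
    let T := (Finset.range 3).image (t ^ ·)
    let U := (Finset.range 3).image (u ^ ·)
    ∀ g ∈ T, ∀ h ∈ U, g * h ∈ S → g = 1 ∧ h = 1 := by
  decide +kernel

/-- `|SL₂(𝔽₅)| = 120` (kernel count; the printed `|G|` column).
[cite: HedtkeMurthy2012, Table 4 (tab:SL) row SL₂𝔽₅] -/
private theorem card_sl2f5 : Fintype.card SL(2, ZMod 5) = 120 := by
  decide +kernel

/-- **Hedtke–Murthy 2012, Table 4 row `SL₂𝔽₅` (`⟨24,3,3⟩`), the triple**: in `SL₂(𝔽₅)` the binary tetrahedral subgroup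
`S = {aⁱbʲcᵏ}` (`a = [0 1; 4 0]`, `b = [0 2; 2 0]`, `c = [1 1; 2 3]`; order `24`) and the cyclic subgroups `T = ⟨[0
3; 3 4]⟩`, `U = ⟨[0 2; 2 4]⟩` (order `3`) satisfy the triple product property. [cite: HedtkeMurthy2012, Table 4
(tab:SL) row SL₂𝔽₅] -/
theorem HedtkeMurthy2012_tableSL_sl2f5_triple :
    let a : SL(2, ZMod 5) := ⟨!![0, 1; 4, 0], by decide⟩
    let b : SL(2, ZMod 5) := ⟨!![0, 2; 2, 0], by decide⟩
    let c : SL(2, ZMod 5) := ⟨!![1, 1; 2, 3], by decide⟩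
    let t : SL(2, ZMod 5) := ⟨!![0, 3; 3, 4], by decide⟩
    let u : SL(2, ZMod 5) := ⟨!![0, 2; 2, 4], by decide⟩
    let S := (Finset.range 4 ×ˢ Finset.range 2 ×ˢ Finset.range 3).image (fun ijk => a ^ ijk.1 * b ^ ijk.2.1 * c ^ ijk.2.2)
    let T := (Finset.range 3).image (t ^ ·)
    let U := (Finset.range 3).image (u ^ ·)
    TripleProductProperty S T U ∧ S.card = 24 ∧ T.card = 3 ∧ U.card = 3 := by
  obtain ⟨hS, hT, hU, hkey⟩ := (⟨factsS_sl2f5, factsT_sl2f5, factsU_sl2f5, key_sl2f5⟩ : _ ∧ _ ∧ _ ∧ _)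
  exact (subgroupTriple_of_carrierFacts hS hT hU hkey).1

/-- **Hedtke–Murthy 2012, Table 4 row `SL₂𝔽₅` ("through subgroups")**: `SL₂(𝔽₅)` has subgroups of orders
`24, 3, 3` satisfying the subgroup triple product property, i.e. `β_g ≥ 216` for this group.
[cite: HedtkeMurthy2012, Table 4 (tab:SL) row SL₂𝔽₅] -/
theorem HedtkeMurthy2012_tableSL_sl2f5_subgroups :
    ∃ H₁ H₂ H₃ : Subgroup SL(2, ZMod 5), Nat.card H₁ = 24 ∧ Nat.card H₂ = 3 ∧ Nat.card H₃ = 3 ∧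
      SubgroupTPP H₁ H₂ H₃ := by
  obtain ⟨-, H₁, H₂, H₃, -, -, -, h1, h2, h3, h⟩ :=
    subgroupTriple_of_carrierFacts factsS_sl2f5 factsT_sl2f5 factsU_sl2f5 key_sl2f5
  exact ⟨H₁, H₂, H₃, h1, h2, h3, h⟩

/-- **Hedtke–Murthy 2012, Table 4 row `SL₂𝔽₅`**: `SL₂(𝔽₅)` realizes `⟨24,3,3⟩`; `|G| = 120` and
`216 = (9/5)·120` (printed ratio `β_g/|G| = 1.8`). [cite: HedtkeMurthy2012, Table 4 (tab:SL) row SL₂𝔽₅] -/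
theorem HedtkeMurthy2012_tableSL_sl2f5 :
    RealizesTPP SL(2, ZMod 5) 24 3 3 ∧ Nat.card SL(2, ZMod 5) = 120 ∧
      5 * (24 * 3 * 3) = 9 * Nat.card SL(2, ZMod 5) := by
  have hc : Nat.card SL(2, ZMod 5) = 120 := by rw [Nat.card_eq_fintype_card]; exact card_sl2f5
  obtain ⟨htpp, h1, h2, h3⟩ := HedtkeMurthy2012_tableSL_sl2f5_triple
  exact ⟨⟨_, _, _, h1, h2, h3, htpp⟩, hc, by rw [hc]⟩

end SL2F5

/-! ## `SL₂(𝔽₇)`: `⟨16, 7, 7⟩` (Table 4 row `SL₂𝔽₇`) -/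

section SL2F7

open scoped MatrixGroups

/-- Carrier facts for `S = {aⁱbʲ : i < 8, j < 2}` with `a = [2 1; 3 2]` (order `8`), `b = [2 2; 1 5]` (order `4`)
(generalized quaternion `Q₁₆`) (kernel computation): size `16`, contains `1`, closed under products, inverses
inside. [cite: HedtkeMurthy2012, Table 4 (tab:SL) row SL₂𝔽₇] -/
private theorem factsS_sl2f7 :
    let a : SL(2, ZMod 7) := ⟨!![2, 1; 3, 2], by decide⟩
    let b : SL(2, ZMod 7) := ⟨!![2, 2; 1, 5], by decide⟩
    let X := (Finset.range 8 ×ˢ Finset.range 2).image (fun ij => a ^ ij.1 * b ^ ij.2)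
    X.card = 16 ∧ (1 : SL(2, ZMod 7)) ∈ X ∧ (∀ x ∈ X, ∀ y ∈ X, x * y ∈ X) ∧
      (∀ x ∈ X, ∃ y ∈ X, x * y = 1) := by
  decide +kernel

/-- Carrier facts for `T = {tⁱ : i < 7}`, `t = [1 1; 0 1]` (upper unitriangular) (kernel computation): size `7`,
contains `1`, closed under products, inverses inside. [cite: HedtkeMurthy2012, Table 4 (tab:SL) row SL₂𝔽₇] -/
private theorem factsT_sl2f7 :
    let t : SL(2, ZMod 7) := ⟨!![1, 1; 0, 1], by decide⟩
    let X := (Finset.range 7).image (t ^ ·)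
    X.card = 7 ∧ (1 : SL(2, ZMod 7)) ∈ X ∧ (∀ x ∈ X, ∀ y ∈ X, x * y ∈ X) ∧
      (∀ x ∈ X, ∃ y ∈ X, x * y = 1) := by
  decide +kernel

/-- Carrier facts for `U = {uʲ : j < 7}`, `u = [1 0; 1 1]` (lower unitriangular) (kernel computation): size `7`,
contains `1`, closed under products, inverses inside. [cite: HedtkeMurthy2012, Table 4 (tab:SL) row SL₂𝔽₇] -/
private theorem factsU_sl2f7 :
    let u : SL(2, ZMod 7) := ⟨!![1, 0; 1, 1], by decide⟩
    let X := (Finset.range 7).image (u ^ ·)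
    X.card = 7 ∧ (1 : SL(2, ZMod 7)) ∈ X ∧ (∀ x ∈ X, ∀ y ∈ X, x * y ∈ X) ∧
      (∀ x ∈ X, ∃ y ∈ X, x * y = 1) := by
  decide +kernel

/-- The key clause (kernel computation over `|T|·|U| = 49` products): `g h ∈ S` with `g ∈ T`,
`h ∈ U` only for `g = h = 1` — i.e. "`T ∩ U = 1` and `S ∩ TU = 1`".
[cite: HedtkeMurthy2012, Table 4 (tab:SL) row SL₂𝔽₇] -/
private theorem key_sl2f7 :
    let a : SL(2, ZMod 7) := ⟨!![2, 1; 3, 2], by decide⟩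
    let b : SL(2, ZMod 7) := ⟨!![2, 2; 1, 5], by decide⟩
    let t : SL(2, ZMod 7) := ⟨!![1, 1; 0, 1], by decide⟩
    let u : SL(2, ZMod 7) := ⟨!![1, 0; 1, 1], by decide⟩
    let S := (Finset.range 8 ×ˢ Finset.range 2).image (fun ij => a ^ ij.1 * b ^ ij.2)
    let T := (Finset.range 7).image (t ^ ·)
    let U := (Finset.range 7).image (u ^ ·)
    ∀ g ∈ T, ∀ h ∈ U, g * h ∈ S → g = 1 ∧ h = 1 := by
  decide +kernel

/-- `|SL₂(𝔽₇)| = 336` (kernel count; the printed `|G|` column).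
[cite: HedtkeMurthy2012, Table 4 (tab:SL) row SL₂𝔽₇] -/
private theorem card_sl2f7 : Fintype.card SL(2, ZMod 7) = 336 := by
  decide +kernel

/-- Structure of the chosen generators (kernel computation): `a = [2 1; 3 2]` has `a⁸ = 1 ≠ a⁴`, `b = [2 2; 1 5]`
satisfies `b² = a⁴` and `b a b⁻¹ = a⁻¹` (so `S = ⟨a, b⟩` is generalized quaternion of order `16`, a Sylow
`2`-subgroup of `SL₂(𝔽₇)`, `|SL₂(𝔽₇)| = 336 = 16·21`), and `t = [1 1; 0 1]`, `u = [1 0; 1 1]` satisfy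
`t⁷ = u⁷ = 1`, `t, u ≠ 1`. [folklore] -/
private theorem relations_sl2f7 :
    let a : SL(2, ZMod 7) := ⟨!![2, 1; 3, 2], by decide⟩
    let b : SL(2, ZMod 7) := ⟨!![2, 2; 1, 5], by decide⟩
    let t : SL(2, ZMod 7) := ⟨!![1, 1; 0, 1], by decide⟩
    let u : SL(2, ZMod 7) := ⟨!![1, 0; 1, 1], by decide⟩
    (a ^ 8 = 1 ∧ a ^ 4 ≠ 1 ∧ b ^ 2 = a ^ 4 ∧ b * a * b⁻¹ = a⁻¹) ∧ (t ^ 7 = 1 ∧ t ≠ 1) ∧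
      (u ^ 7 = 1 ∧ u ≠ 1) := by
  decide +kernel

/-- **Hedtke–Murthy 2012, Table 4 row `SL₂𝔽₇` (`⟨16,7,7⟩`), the triple**: in `SL₂(𝔽₇)` the generalized quaternion
subgroup `S = {aⁱbʲ : i < 8, j < 2}` (`a = [2 1; 3 2]`, `b = [2 2; 1 5]`; order `16`) and the unitriangular
subgroups `T = ⟨[1 1; 0 1]⟩`, `U = ⟨[1 0; 1 1]⟩` (order `7`) satisfy the triple product property. [cite:
HedtkeMurthy2012, Table 4 (tab:SL) row SL₂𝔽₇] -/
theorem HedtkeMurthy2012_tableSL_sl2f7_triple :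
    let a : SL(2, ZMod 7) := ⟨!![2, 1; 3, 2], by decide⟩
    let b : SL(2, ZMod 7) := ⟨!![2, 2; 1, 5], by decide⟩
    let t : SL(2, ZMod 7) := ⟨!![1, 1; 0, 1], by decide⟩
    let u : SL(2, ZMod 7) := ⟨!![1, 0; 1, 1], by decide⟩
    let S := (Finset.range 8 ×ˢ Finset.range 2).image (fun ij => a ^ ij.1 * b ^ ij.2)
    let T := (Finset.range 7).image (t ^ ·)
    let U := (Finset.range 7).image (u ^ ·)
    TripleProductProperty S T U ∧ S.card = 16 ∧ T.card = 7 ∧ U.card = 7 := by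
  obtain ⟨hS, hT, hU, hkey⟩ := (⟨factsS_sl2f7, factsT_sl2f7, factsU_sl2f7, key_sl2f7⟩ : _ ∧ _ ∧ _ ∧ _)
  exact (subgroupTriple_of_carrierFacts hS hT hU hkey).1

/-- **Hedtke–Murthy 2012, Table 4 row `SL₂𝔽₇` ("through subgroups")**: `SL₂(𝔽₇)` has subgroups of orders
`16, 7, 7` satisfying the subgroup triple product property, i.e. `β_g ≥ 784` for this group.
[cite: HedtkeMurthy2012, Table 4 (tab:SL) row SL₂𝔽₇] -/
theorem HedtkeMurthy2012_tableSL_sl2f7_subgroups :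
    ∃ H₁ H₂ H₃ : Subgroup SL(2, ZMod 7), Nat.card H₁ = 16 ∧ Nat.card H₂ = 7 ∧ Nat.card H₃ = 7 ∧
      SubgroupTPP H₁ H₂ H₃ := by
  obtain ⟨-, H₁, H₂, H₃, -, -, -, h1, h2, h3, h⟩ :=
    subgroupTriple_of_carrierFacts factsS_sl2f7 factsT_sl2f7 factsU_sl2f7 key_sl2f7
  exact ⟨H₁, H₂, H₃, h1, h2, h3, h⟩

/-- **Hedtke–Murthy 2012, Table 4 row `SL₂𝔽₇`**: `SL₂(𝔽₇)` realizes `⟨16,7,7⟩`; `|G| = 336` and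
`784 = (7/3)·336` (printed ratio `β_g/|G| = 2.33333`). [cite: HedtkeMurthy2012, Table 4 (tab:SL) row SL₂𝔽₇] -/
theorem HedtkeMurthy2012_tableSL_sl2f7 :
    RealizesTPP SL(2, ZMod 7) 16 7 7 ∧ Nat.card SL(2, ZMod 7) = 336 ∧
      3 * (16 * 7 * 7) = 7 * Nat.card SL(2, ZMod 7) := by
  have hc : Nat.card SL(2, ZMod 7) = 336 := by rw [Nat.card_eq_fintype_card]; exact card_sl2f7
  obtain ⟨htpp, h1, h2, h3⟩ := HedtkeMurthy2012_tableSL_sl2f7_triple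
  exact ⟨⟨_, _, _, h1, h2, h3, htpp⟩, hc, by rw [hc]⟩

end SL2F7

/-! ## `A₅ ≅ PSL₂(𝔽₄) ≅ PSL₂(𝔽₅) ≅ SL₂(𝔽₄)`: `⟨12, 3, 3⟩` (Table 3 rows `PSL₂𝔽₄`, `PSL₂𝔽₅`; Table 4 row `SL₂𝔽₄`) -/

section Alt5

/-- Carrier facts for `S = {aⁱbʲcᵏ : i, j < 2, k < 3} = A₄` on `{0,1,2,3}` (`a = (0 1)(2 3)`, `b = (0 2)(1 3)`, `c = (0
1 2)`) (kernel computation): size `12`, contains `1`, closed under products, inverses inside, every element is an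
even permutation. [cite: HedtkeMurthy2012, Table 3 (tab:PSL) row PSL₂𝔽₅] -/
private theorem factsS_alt5 :
    let a : Perm (Fin 5) := swap 0 1 * swap 2 3
    let b : Perm (Fin 5) := swap 0 2 * swap 1 3
    let c : Perm (Fin 5) := swap 0 2 * swap 0 1
    let X := (Finset.range 2 ×ˢ Finset.range 2 ×ˢ Finset.range 3).image (fun ijk => a ^ ijk.1 * b ^ ijk.2.1 * c ^ ijk.2.2)
    X.card = 12 ∧ (1 : Perm (Fin 5)) ∈ X ∧ (∀ x ∈ X, ∀ y ∈ X, x * y ∈ X) ∧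
      (∀ x ∈ X, ∃ y ∈ X, x * y = 1) ∧ (∀ x ∈ X, Perm.sign x = 1) := by
  decide +kernel

/-- Carrier facts for `T = ⟨(0 1 4)⟩ = {tⁱ : i < 3}`, `t = swap 0 4 * swap 0 1` (kernel computation): size `3`, contains
`1`, closed under products, inverses inside, every element is an even permutation. [cite: HedtkeMurthy2012, Table 3
(tab:PSL) row PSL₂𝔽₅] -/
private theorem factsT_alt5 :
    let t : Perm (Fin 5) := swap 0 4 * swap 0 1
    let X := (Finset.range 3).image (t ^ ·)
    X.card = 3 ∧ (1 : Perm (Fin 5)) ∈ X ∧ (∀ x ∈ X, ∀ y ∈ X, x * y ∈ X) ∧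
      (∀ x ∈ X, ∃ y ∈ X, x * y = 1) ∧ (∀ x ∈ X, Perm.sign x = 1) := by
  decide +kernel

/-- Carrier facts for `U = ⟨(2 3 4)⟩ = {uʲ : j < 3}`, `u = swap 2 4 * swap 2 3` (kernel computation): size `3`, contains
`1`, closed under products, inverses inside, every element is an even permutation. [cite: HedtkeMurthy2012, Table 3
(tab:PSL) row PSL₂𝔽₅] -/
private theorem factsU_alt5 :
    let u : Perm (Fin 5) := swap 2 4 * swap 2 3
    let X := (Finset.range 3).image (u ^ ·)
    X.card = 3 ∧ (1 : Perm (Fin 5)) ∈ X ∧ (∀ x ∈ X, ∀ y ∈ X, x * y ∈ X) ∧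
      (∀ x ∈ X, ∃ y ∈ X, x * y = 1) ∧ (∀ x ∈ X, Perm.sign x = 1) := by
  decide +kernel

/-- The key clause (kernel computation over `|T|·|U| = 9` products): `g h ∈ S` with `g ∈ T`,
`h ∈ U` only for `g = h = 1` — i.e. "`T ∩ U = 1` and `S ∩ TU = 1`".
[cite: HedtkeMurthy2012, Table 3 (tab:PSL) row PSL₂𝔽₅] -/
private theorem key_alt5 :
    let a : Perm (Fin 5) := swap 0 1 * swap 2 3
    let b : Perm (Fin 5) := swap 0 2 * swap 1 3
    let c : Perm (Fin 5) := swap 0 2 * swap 0 1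
    let t : Perm (Fin 5) := swap 0 4 * swap 0 1
    let u : Perm (Fin 5) := swap 2 4 * swap 2 3
    let S := (Finset.range 2 ×ˢ Finset.range 2 ×ˢ Finset.range 3).image (fun ijk => a ^ ijk.1 * b ^ ijk.2.1 * c ^ ijk.2.2)
    let T := (Finset.range 3).image (t ^ ·)
    let U := (Finset.range 3).image (u ^ ·)
    ∀ g ∈ T, ∀ h ∈ U, g * h ∈ S → g = 1 ∧ h = 1 := by
  decide +kernel

/-- **Hedtke–Murthy 2012, Table 3 rows `PSL₂𝔽₄`, `PSL₂𝔽₅` / Table 4 row `SL₂𝔽₄` (all `≅ A₅`) (`⟨12,3,3⟩`), the triple**: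
in `S₅ ⊇ A₅` the sets `S = A₄` (the even permutations of `{0,1,2,3}`), `T = ⟨(0 1 4)⟩`, `U = ⟨(2 3 4)⟩` satisfy the
triple product property, have sizes `12, 3, 3`, and consist of even permutations (the printed groups are `PSL₂𝔽₄ ≅
PSL₂𝔽₅ ≅ SL₂𝔽₄ ≅ A₅`; these isomorphisms are not formalized). [cite: HedtkeMurthy2012, Table 3 (tab:PSL) row PSL₂𝔽₅] -/
theorem HedtkeMurthy2012_tablePSL_alt5_triple :
    let a : Perm (Fin 5) := swap 0 1 * swap 2 3
    let b : Perm (Fin 5) := swap 0 2 * swap 1 3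
    let c : Perm (Fin 5) := swap 0 2 * swap 0 1
    let t : Perm (Fin 5) := swap 0 4 * swap 0 1
    let u : Perm (Fin 5) := swap 2 4 * swap 2 3
    let S := (Finset.range 2 ×ˢ Finset.range 2 ×ˢ Finset.range 3).image (fun ijk => a ^ ijk.1 * b ^ ijk.2.1 * c ^ ijk.2.2)
    let T := (Finset.range 3).image (t ^ ·)
    let U := (Finset.range 3).image (u ^ ·)
    (TripleProductProperty S T U ∧ S.card = 12 ∧ T.card = 3 ∧ U.card = 3) ∧
      ((∀ g ∈ S, g ∈ alternatingGroup (Fin 5)) ∧ (∀ g ∈ T, g ∈ alternatingGroup (Fin 5)) ∧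
        (∀ g ∈ U, g ∈ alternatingGroup (Fin 5))) := by
  obtain ⟨⟨hS, sS⟩, ⟨hT, sT⟩, ⟨hU, sU⟩, hkey⟩ :=
    (⟨and_assoc4 factsS_alt5, and_assoc4 factsT_alt5, and_assoc4 factsU_alt5, key_alt5⟩ : _ ∧ _ ∧ _ ∧ _)
  exact ⟨(subgroupTriple_of_carrierFacts hS hT hU hkey).1,
    fun g hg => Perm.mem_alternatingGroup.mpr (sS g hg), fun g hg => Perm.mem_alternatingGroup.mpr (sT g hg),
    fun g hg => Perm.mem_alternatingGroup.mpr (sU g hg)⟩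

/-- **Hedtke–Murthy 2012, Table 3 rows `PSL₂𝔽₄`, `PSL₂𝔽₅` / Table 4 row `SL₂𝔽₄` (all `≅ A₅`) ("through subgroups")**:
`A₅ = alternatingGroup (Fin 5)` has subgroups of orders `12, 3, 3` satisfying the subgroup triple product property,
i.e. `β_g(A_5) ≥ 108`. [cite: HedtkeMurthy2012, Table 3 (tab:PSL) row PSL₂𝔽₅] -/
theorem HedtkeMurthy2012_tablePSL_alt5_subgroups :
    ∃ K₁ K₂ K₃ : Subgroup (alternatingGroup (Fin 5)),
      Nat.card K₁ = 12 ∧ Nat.card K₂ = 3 ∧ Nat.card K₃ = 3 ∧ SubgroupTPP K₁ K₂ K₃ := by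
  obtain ⟨⟨hS, sS⟩, ⟨hT, sT⟩, ⟨hU, sU⟩, hkey⟩ :=
    (⟨and_assoc4 factsS_alt5, and_assoc4 factsT_alt5, and_assoc4 factsU_alt5, key_alt5⟩ : _ ∧ _ ∧ _ ∧ _)
  obtain ⟨-, H₁, H₂, H₃, e₁, e₂, e₃, h1, h2, h3, h⟩ := subgroupTriple_of_carrierFacts hS hT hU hkey
  refine ⟨H₁.subgroupOf _, H₂.subgroupOf _, H₃.subgroupOf _, ?_, ?_, ?_, subgroupTPP_subgroupOf _ _ _ _ h⟩
  · rw [card_subgroupOf_of_sign H₁ e₁ sS, h1]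
  · rw [card_subgroupOf_of_sign H₂ e₂ sT, h2]
  · rw [card_subgroupOf_of_sign H₃ e₃ sU, h3]

/-- **Hedtke–Murthy 2012, Table 3 rows `PSL₂𝔽₄`, `PSL₂𝔽₅` / Table 4 row `SL₂𝔽₄` (all `≅ A₅`)**: `A₅ = alternatingGroup
(Fin 5)` realizes `⟨12,3,3⟩`; `|A_5| = 60` and `108 = (9/5)·60` (printed ratio `β_g/|G| = 1.8`). [cite:
HedtkeMurthy2012, Table 3 (tab:PSL) row PSL₂𝔽₅] -/
theorem HedtkeMurthy2012_tablePSL_alt5 :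
    RealizesTPP (alternatingGroup (Fin 5)) 12 3 3 ∧ Nat.card (alternatingGroup (Fin 5)) = 60 ∧
      5 * (12 * 3 * 3) = 9 * Nat.card (alternatingGroup (Fin 5)) := by
  have hc : Nat.card (alternatingGroup (Fin 5)) = 60 := by
    rw [nat_card_alternatingGroup]; simp [Nat.factorial]
  obtain ⟨⟨htpp, h1, h2, h3⟩, sS, sT, sU⟩ := HedtkeMurthy2012_tablePSL_alt5_triple
  have h := realizesTPP_subgroup_of_subset (alternatingGroup (Fin 5)) sS sT sU htpp
  rw [h1, h2, h3] at h
  exact ⟨h, hc, by rw [hc]⟩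

end Alt5

/-! ## `A₆ ≅ PSL₂(𝔽₉)`: `⟨12, 9, 9⟩` (Table 3 row `PSL₂𝔽₉`) -/

section Alt6

/-- Carrier facts for `S = A₄` on `{0,1,2,3}` (as for `A₅`, now in `Perm (Fin 6)`) (kernel computation): size `12`,
contains `1`, closed under products, inverses inside, every element is an even permutation. [cite: HedtkeMurthy2012,
Table 3 (tab:PSL) row PSL₂𝔽₉] -/
private theorem factsS_alt6 :
    let a : Perm (Fin 6) := swap 0 1 * swap 2 3
    let b : Perm (Fin 6) := swap 0 2 * swap 1 3
    let c : Perm (Fin 6) := swap 0 2 * swap 0 1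
    let X := (Finset.range 2 ×ˢ Finset.range 2 ×ˢ Finset.range 3).image (fun ijk => a ^ ijk.1 * b ^ ijk.2.1 * c ^ ijk.2.2)
    X.card = 12 ∧ (1 : Perm (Fin 6)) ∈ X ∧ (∀ x ∈ X, ∀ y ∈ X, x * y ∈ X) ∧
      (∀ x ∈ X, ∃ y ∈ X, x * y = 1) ∧ (∀ x ∈ X, Perm.sign x = 1) := by
  decide +kernel

/-- Carrier facts for `T = {xⁱyʲ : i, j < 3} = ⟨(0 1 4), (2 5 3)⟩` (`x = swap 0 4 * swap 0 1`, `y = swap 2 3 * swap 2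
5`) (kernel computation): size `9`, contains `1`, closed under products, inverses inside, every element is an even
permutation. [cite: HedtkeMurthy2012, Table 3 (tab:PSL) row PSL₂𝔽₉] -/
private theorem factsT_alt6 :
    let x : Perm (Fin 6) := swap 0 4 * swap 0 1
    let y : Perm (Fin 6) := swap 2 3 * swap 2 5
    let X := (Finset.range 3 ×ˢ Finset.range 3).image (fun ij => x ^ ij.1 * y ^ ij.2)
    X.card = 9 ∧ (1 : Perm (Fin 6)) ∈ X ∧ (∀ x ∈ X, ∀ y ∈ X, x * y ∈ X) ∧
      (∀ x ∈ X, ∃ y ∈ X, x * y = 1) ∧ (∀ x ∈ X, Perm.sign x = 1) := by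
  decide +kernel

/-- Carrier facts for `U = {x'ⁱy'ʲ : i, j < 3} = ⟨(2 3 4), (0 1 5)⟩` (`x' = swap 2 4 * swap 2 3`, `y' = swap 0 5 * swap
0 1`) (kernel computation): size `9`, contains `1`, closed under products, inverses inside, every element is an even
permutation. [cite: HedtkeMurthy2012, Table 3 (tab:PSL) row PSL₂𝔽₉] -/
private theorem factsU_alt6 :
    let x' : Perm (Fin 6) := swap 2 4 * swap 2 3
    let y' : Perm (Fin 6) := swap 0 5 * swap 0 1
    let X := (Finset.range 3 ×ˢ Finset.range 3).image (fun ij => x' ^ ij.1 * y' ^ ij.2)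
    X.card = 9 ∧ (1 : Perm (Fin 6)) ∈ X ∧ (∀ x ∈ X, ∀ y ∈ X, x * y ∈ X) ∧
      (∀ x ∈ X, ∃ y ∈ X, x * y = 1) ∧ (∀ x ∈ X, Perm.sign x = 1) := by
  decide +kernel

/-- The key clause (kernel computation over `|T|·|U| = 81` products): `g h ∈ S` with `g ∈ T`,
`h ∈ U` only for `g = h = 1` — i.e. "`T ∩ U = 1` and `S ∩ TU = 1`".
[cite: HedtkeMurthy2012, Table 3 (tab:PSL) row PSL₂𝔽₉] -/
private theorem key_alt6 :
    let a : Perm (Fin 6) := swap 0 1 * swap 2 3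
    let b : Perm (Fin 6) := swap 0 2 * swap 1 3
    let c : Perm (Fin 6) := swap 0 2 * swap 0 1
    let x : Perm (Fin 6) := swap 0 4 * swap 0 1
    let y : Perm (Fin 6) := swap 2 3 * swap 2 5
    let x' : Perm (Fin 6) := swap 2 4 * swap 2 3
    let y' : Perm (Fin 6) := swap 0 5 * swap 0 1
    let S := (Finset.range 2 ×ˢ Finset.range 2 ×ˢ Finset.range 3).image (fun ijk => a ^ ijk.1 * b ^ ijk.2.1 * c ^ ijk.2.2)
    let T := (Finset.range 3 ×ˢ Finset.range 3).image (fun ij => x ^ ij.1 * y ^ ij.2)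
    let U := (Finset.range 3 ×ˢ Finset.range 3).image (fun ij => x' ^ ij.1 * y' ^ ij.2)
    ∀ g ∈ T, ∀ h ∈ U, g * h ∈ S → g = 1 ∧ h = 1 := by
  decide +kernel

/-- **Hedtke–Murthy 2012, Table 3 row `PSL₂𝔽₉` (`≅ A₆`) (`⟨12,9,9⟩`), the triple**: in `S₆ ⊇ A₆` the sets `S = A₄` on
`{0,1,2,3}`, `T = ⟨(0 1 4), (2 5 3)⟩`, `U = ⟨(2 3 4), (0 1 5)⟩` satisfy the triple product property, have sizes `12,
9, 9`, and consist of even permutations (the printed group is `PSL₂𝔽₉ ≅ A₆`; the isomorphism is not formalized).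
[cite: HedtkeMurthy2012, Table 3 (tab:PSL) row PSL₂𝔽₉] -/
theorem HedtkeMurthy2012_tablePSL_alt6_triple :
    let a : Perm (Fin 6) := swap 0 1 * swap 2 3
    let b : Perm (Fin 6) := swap 0 2 * swap 1 3
    let c : Perm (Fin 6) := swap 0 2 * swap 0 1
    let x : Perm (Fin 6) := swap 0 4 * swap 0 1
    let y : Perm (Fin 6) := swap 2 3 * swap 2 5
    let x' : Perm (Fin 6) := swap 2 4 * swap 2 3
    let y' : Perm (Fin 6) := swap 0 5 * swap 0 1
    let S := (Finset.range 2 ×ˢ Finset.range 2 ×ˢ Finset.range 3).image (fun ijk => a ^ ijk.1 * b ^ ijk.2.1 * c ^ ijk.2.2)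
    let T := (Finset.range 3 ×ˢ Finset.range 3).image (fun ij => x ^ ij.1 * y ^ ij.2)
    let U := (Finset.range 3 ×ˢ Finset.range 3).image (fun ij => x' ^ ij.1 * y' ^ ij.2)
    (TripleProductProperty S T U ∧ S.card = 12 ∧ T.card = 9 ∧ U.card = 9) ∧
      ((∀ g ∈ S, g ∈ alternatingGroup (Fin 6)) ∧ (∀ g ∈ T, g ∈ alternatingGroup (Fin 6)) ∧
        (∀ g ∈ U, g ∈ alternatingGroup (Fin 6))) := by
  obtain ⟨⟨hS, sS⟩, ⟨hT, sT⟩, ⟨hU, sU⟩, hkey⟩ :=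
    (⟨and_assoc4 factsS_alt6, and_assoc4 factsT_alt6, and_assoc4 factsU_alt6, key_alt6⟩ : _ ∧ _ ∧ _ ∧ _)
  exact ⟨(subgroupTriple_of_carrierFacts hS hT hU hkey).1,
    fun g hg => Perm.mem_alternatingGroup.mpr (sS g hg), fun g hg => Perm.mem_alternatingGroup.mpr (sT g hg),
    fun g hg => Perm.mem_alternatingGroup.mpr (sU g hg)⟩

/-- **Hedtke–Murthy 2012, Table 3 row `PSL₂𝔽₉` (`≅ A₆`) ("through subgroups")**: `A₆ = alternatingGroup (Fin 6)` has
subgroups of orders `12, 9, 9` satisfying the subgroup triple product property, i.e. `β_g(A_6) ≥ 972`. [cite: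
HedtkeMurthy2012, Table 3 (tab:PSL) row PSL₂𝔽₉] -/
theorem HedtkeMurthy2012_tablePSL_alt6_subgroups :
    ∃ K₁ K₂ K₃ : Subgroup (alternatingGroup (Fin 6)),
      Nat.card K₁ = 12 ∧ Nat.card K₂ = 9 ∧ Nat.card K₃ = 9 ∧ SubgroupTPP K₁ K₂ K₃ := by
  obtain ⟨⟨hS, sS⟩, ⟨hT, sT⟩, ⟨hU, sU⟩, hkey⟩ :=
    (⟨and_assoc4 factsS_alt6, and_assoc4 factsT_alt6, and_assoc4 factsU_alt6, key_alt6⟩ : _ ∧ _ ∧ _ ∧ _)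
  obtain ⟨-, H₁, H₂, H₃, e₁, e₂, e₃, h1, h2, h3, h⟩ := subgroupTriple_of_carrierFacts hS hT hU hkey
  refine ⟨H₁.subgroupOf _, H₂.subgroupOf _, H₃.subgroupOf _, ?_, ?_, ?_, subgroupTPP_subgroupOf _ _ _ _ h⟩
  · rw [card_subgroupOf_of_sign H₁ e₁ sS, h1]
  · rw [card_subgroupOf_of_sign H₂ e₂ sT, h2]
  · rw [card_subgroupOf_of_sign H₃ e₃ sU, h3]

/-- **Hedtke–Murthy 2012, Table 3 row `PSL₂𝔽₉` (`≅ A₆`)**: `A₆ = alternatingGroup (Fin 6)` realizes `⟨12,9,9⟩`; `|A_6| =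
360` and `972 = (27/10)·360` (printed ratio `β_g/|G| = 2.7`). [cite: HedtkeMurthy2012, Table 3 (tab:PSL) row PSL₂𝔽₉] -/
theorem HedtkeMurthy2012_tablePSL_alt6 :
    RealizesTPP (alternatingGroup (Fin 6)) 12 9 9 ∧ Nat.card (alternatingGroup (Fin 6)) = 360 ∧
      10 * (12 * 9 * 9) = 27 * Nat.card (alternatingGroup (Fin 6)) := by
  have hc : Nat.card (alternatingGroup (Fin 6)) = 360 := by
    rw [nat_card_alternatingGroup]; simp [Nat.factorial]
  obtain ⟨⟨htpp, h1, h2, h3⟩, sS, sT, sU⟩ := HedtkeMurthy2012_tablePSL_alt6_triple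
  have h := realizesTPP_subgroup_of_subset (alternatingGroup (Fin 6)) sS sT sU htpp
  rw [h1, h2, h3] at h
  exact ⟨h, hc, by rw [hc]⟩

end Alt6
end Literature.Computability.AlgebraicComplexity
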